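import Summits.Ventures.YMGap.Thresholds.SharpUniquenessDLR
import Literature.MathematicalPhysics.QuantumLattice.LatticeGaugeDLRBoxKernels
import Literature.Probability.LatticeModels.SharpnessProofs
import Mathlib.Analysis.SpecialFunctions.Pow.Asymptotics
import HarnessLib

/-!
# Venture YMGap — OBJECT U, the JOIN: boundary-tilt bound (U3) ⇒ vanishing boundary influence along
# cubes ⇒ DLR uniqueness at the sharp window ⇒ the cell's target type `ImprovedThreshold d N (1/(8d))`

HONEST FRAMING: venture file (cell `pub-ymgap`, track (a), OBJECT U of PLAN R132/R132′, seat p1).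
Strong-coupling LATTICE statements for `SU(N)` Wilson lattice Yang–Mills on `ℤ^d`; nothing about the
continuum. This file is the geometric hinge between piece U3 (`Thresholds/RegionBoundaryTilt.lean`, seat p2:
for smooth cylinder observables `matrixCylinder Λ f` with per-link Lipschitz data `δ`, the kernel means
`γ_E(· | η)` and `γ_E(· | η')` differ by at most `C · (Σδ) · Σ_{b ∈ collar(E) \ E} e^{-κ · dist(Λ, b)}`,
uniformly in the boundary conditions) and piece U4 (`SharpUniquenessDLR`: vanishing boundary influence ⇒
unique DLR state). KERNEL-CHECKED HERE: (i) the cube geometry of `ℤ^d` — the collar of the cube of links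
`Λ_R = box d R × {directions}` lies in `Λ_{R+1}` (`collar_cube_subset`), has at most `d (2R+3)^d` links, and
every collar link outside `Λ_R` is at sup-distance `≥ R + 1 − R₀` from any `Λ ⊆ Λ_{R₀}`
(`le_setDistEdges_of_not_mem_cube`), so the U3 bound along cubes is `≤ C (Σδ) d (2R+3)^d e^{-κ(R+1-R₀)} → 0`
(`smoothKernelInfluenceVanishes_of_boundaryBound`); (ii) the compositions: a boundary bound at tree coupling
`β` ⇒ `HasUniqueGibbsMeasure` (`hasUniqueGibbsMeasure_of_boundaryBound`); a boundary bound at every 't Hooft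
coupling `|β'| < 1/(8d)` ⇒ the cell's uniqueness claim `HessianSharp.SharpUniqueness d N`
(`sharpUniqueness_of_boundaryBound`) ⇒ with the SZZ transfer fact `MassGapBelow d N (1/(8d))` and, for
`d ≥ 3`, `ImprovedThreshold d N (1/(8d))` (`improvedThreshold_sharp_of_boundaryBound`). The U3 bound enters
as an explicit HYPOTHESIS binder (the shape of p2's ★ `kernel_boundary_influence_le`, bus 15:56Z); when U1
(ds-2), U2 (lit-1) and U3 (p2) are in the tree the hypothesis-free corollaries are appended. Nothing is
asserted about the binder.

References: H.-O. Georgii (2011) Remark 1.24, Thm. 8.7 ff. (uniqueness from vanishing boundary influence);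
H. Shen, R. Zhu, X. Zhu, CMP 400 (2023) Rem. 1.3, Cor. 4.11; cell bus 2026-08-22 15:23Z–16:10Z.
-/

noncomputable section

open scoped Matrix BigOperators Matrix.Norms.Frobenius ContDiff Topology NNReal
open MeasureTheory Filter Function Finset
open Literature.Probability.LatticeModels
open Literature.MathematicalPhysics.QuantumLattice (fundamentalRep continuous_fundamentalRep LGConfig ZdEdge
  ymSpecification ymGibbsMeasures plaquettesTouching plaquetteEdges exists_near_of_mem_collar)
open Literature.MathematicalPhysics.QuantumFieldTheory hiding ZdEdge
open Summit.Ventures.YMGap.LatticeBakryEmery (Cfg PSU emb emb_apply LinkLipschitz)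
open Summit.Ventures.YMGap.SharpUniquenessDLR

namespace Summit.Ventures.YMGap

namespace SharpUniquenessJoin

variable {d N : ℕ}

/-! ### Cube geometry of `ℤ^d`: the collar of a cube of links -/

/-- An edge set `Λ` lies in the cube of links `box d R₀ × {directions}` for `R₀` the largest sup-norm of
its base points. -/
theorem exists_subset_cube (Λ : Finset (ZdEdge d)) :
    ∃ R₀ : ℕ, Λ ⊆ box d R₀ ×ˢ (Finset.univ : Finset (Fin d)) := by
  refine ⟨Λ.sup fun a => Site.supNorm a.1, fun a ha => ?_⟩
  rw [Finset.mem_product]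
  refine ⟨mem_box_iff_supNorm_le.2 ?_, Finset.mem_univ _⟩
  exact Finset.le_sup (f := fun a : ZdEdge d => Site.supNorm a.1) ha

/-- The collar of the cube of links `Λ_R = box d R × {directions}` (the links of the plaquettes touching
it) lies in `Λ_{R+1}`: the Wilson interaction has range one (`exists_near_of_mem_collar`). -/
theorem collar_cube_subset (R : ℕ) :
    (plaquettesTouching (box d R ×ˢ (Finset.univ : Finset (Fin d)))).biUnion plaquetteEdges ⊆
      box d (R + 1) ×ˢ (Finset.univ : Finset (Fin d)) := by
  intro e he
  obtain ⟨e', he', hnear⟩ := exists_near_of_mem_collar he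
  rw [Finset.mem_product] at he' ⊢
  refine ⟨mem_box.2 fun k => ?_, Finset.mem_univ _⟩
  have h1 := (mem_box.1 he'.1) k
  have h2 := hnear k
  push_cast
  omega

/-- Hence the collar links outside the cube number at most `d (2R+3)^d`. -/
theorem card_collar_sdiff_cube_le (R : ℕ) :
    (((plaquettesTouching (box d R ×ˢ (Finset.univ : Finset (Fin d)))).biUnion plaquetteEdges) \
        (box d R ×ˢ (Finset.univ : Finset (Fin d)))).card ≤ d * (2 * R + 3) ^ d := by
  calc _ ≤ ((plaquettesTouching (box d R ×ˢ (Finset.univ : Finset (Fin d)))).biUnion plaquetteEdges).card :=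
        Finset.card_le_card Finset.sdiff_subset
    _ ≤ (box d (R + 1) ×ˢ (Finset.univ : Finset (Fin d))).card := Finset.card_le_card (collar_cube_subset R)
    _ = d * (2 * R + 3) ^ d := by
        rw [Finset.card_product, card_box, Finset.card_univ, Fintype.card_fin]; ring

/-- A link outside the cube `Λ_R` is at sup-distance `≥ R + 1 − R₀` (base points) from every link set
`Λ ⊆ Λ_{R₀}`: `setDistEdges Λ {b} ≥ R + 1 − R₀` (for `Λ` non-empty; the tree's `setDistEdges` is the
minimum of `‖x − x'‖_∞` over pairs). -/
theorem le_setDistEdges_of_not_mem_cube {Λ : Finset (ZdEdge d)} (hΛ : Λ.Nonempty) {R₀ R : ℕ}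
    (hsub : Λ ⊆ box d R₀ ×ˢ (Finset.univ : Finset (Fin d))) {b : ZdEdge d}
    (hb : b ∉ box d R ×ˢ (Finset.univ : Finset (Fin d))) :
    (R : ℝ) + 1 - R₀ ≤ setDistEdges Λ {b} := by
  have hne : (Λ ×ˢ ({b} : Finset (ZdEdge d))).Nonempty := hΛ.product (Finset.singleton_nonempty b)
  unfold setDistEdges
  rw [dif_pos hne, Finset.le_inf'_iff]
  intro p hp
  rw [Finset.mem_product, Finset.mem_singleton] at hp
  obtain ⟨ha, rfl⟩ := hp
  -- a coordinate of the base point of `b = p.2` exceeds `R` in absolute value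
  have hb' : ¬ ∀ i, -(R : ℤ) ≤ p.2.1 i ∧ p.2.1 i ≤ R := by
    intro h
    exact hb (Finset.mem_product.2 ⟨mem_box.2 h, Finset.mem_univ _⟩)
  push Not at hb'
  obtain ⟨k, hk⟩ := hb'
  have hak : -(R₀ : ℤ) ≤ p.1.1 k ∧ p.1.1 k ≤ R₀ := (mem_box.1 (Finset.mem_product.1 (hsub ha)).1) k
  have hcoord : (R : ℤ) + 1 - R₀ ≤ |(p.1.1 - p.2.1) k| := by
    rw [Pi.sub_apply, abs_sub_comm, le_abs]
    by_cases h : -(R : ℤ) ≤ p.2.1 k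
    · have := hk h; left; omega
    · right; omega
  have hnorm : (|(p.1.1 - p.2.1) k| : ℝ) ≤ ‖p.1.1 - p.2.1‖ := by
    rw [Site.norm_eq_supNorm, ← Int.cast_abs]
    have := Site.natAbs_le_supNorm (p.1.1 - p.2.1) k
    have h' : (|(p.1.1 - p.2.1) k| : ℤ) = (((p.1.1 - p.2.1) k).natAbs : ℤ) := (Int.natCast_natAbs _).symm
    rw [h']; exact_mod_cast this
  have hcoordR : (R : ℝ) + 1 - R₀ ≤ (|(p.1.1 - p.2.1) k| : ℝ) := by exact_mod_cast hcoord
  exact hcoordR.trans hnorm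

/-- The collar sum of the U3 bound along cubes: for `Λ ⊆ Λ_{R₀}` non-empty and `κ ≥ 0`,
`Σ_{b ∈ collar(Λ_R) \ Λ_R} e^{-κ·setDistEdges Λ {b}} ≤ d (2R+3)^d e^{-κ (R + 1 − R₀)}`. -/
theorem collarSum_cube_le {Λ : Finset (ZdEdge d)} (hΛ : Λ.Nonempty) {R₀ : ℕ}
    (hsub : Λ ⊆ box d R₀ ×ˢ (Finset.univ : Finset (Fin d))) {κ : ℝ} (hκ : 0 ≤ κ) (R : ℕ) :
    ∑ b ∈ ((plaquettesTouching (box d R ×ˢ (Finset.univ : Finset (Fin d)))).biUnion plaquetteEdges) \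
        (box d R ×ˢ (Finset.univ : Finset (Fin d))), Real.exp (-κ * setDistEdges Λ {b}) ≤
      d * (2 * R + 3) ^ d * Real.exp (-κ * ((R : ℝ) + 1 - R₀)) := by
  set B := ((plaquettesTouching (box d R ×ˢ (Finset.univ : Finset (Fin d)))).biUnion plaquetteEdges) \
    (box d R ×ˢ (Finset.univ : Finset (Fin d))) with hB
  have hterm : ∀ b ∈ B, Real.exp (-κ * setDistEdges Λ {b}) ≤ Real.exp (-κ * ((R : ℝ) + 1 - R₀)) := by
    intro b hb
    have hb' : b ∉ box d R ×ˢ (Finset.univ : Finset (Fin d)) := (Finset.mem_sdiff.1 hb).2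
    have := le_setDistEdges_of_not_mem_cube hΛ hsub hb'
    exact Real.exp_le_exp.2 (by nlinarith)
  calc ∑ b ∈ B, Real.exp (-κ * setDistEdges Λ {b}) ≤ ∑ b ∈ B, Real.exp (-κ * ((R : ℝ) + 1 - R₀)) :=
        Finset.sum_le_sum hterm
    _ = B.card * Real.exp (-κ * ((R : ℝ) + 1 - R₀)) := by rw [Finset.sum_const, nsmul_eq_mul]
    _ ≤ d * (2 * R + 3) ^ d * Real.exp (-κ * ((R : ℝ) + 1 - R₀)) := by
        refine mul_le_mul_of_nonneg_right ?_ (Real.exp_pos _).le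
        exact_mod_cast card_collar_sdiff_cube_le (d := d) R

/-- `d (2R+3)^d e^{-κ(R+1-R₀)} → 0` as `R → ∞` (`κ > 0`): polynomial growth against exponential decay. -/
theorem tendsto_cubeBound (d R₀ : ℕ) {κ : ℝ} (hκ : 0 < κ) :
    Tendsto (fun R : ℕ => (d : ℝ) * (2 * R + 3) ^ d * Real.exp (-κ * ((R : ℝ) + 1 - R₀))) atTop (𝓝 0) := by
  -- `(2R+3)^d e^{-κ(R+1-R₀)} = const · x^d e^{-(κ/2) x}` at `x = 2R + 3 → ∞`
  have hκ2 : 0 < κ / 2 := half_pos hκ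
  have hlim : Tendsto (fun x : ℝ => x ^ (d : ℝ) * Real.exp (-(κ / 2) * x)) atTop (𝓝 0) :=
    tendsto_rpow_mul_exp_neg_mul_atTop_nhds_zero (d : ℝ) (κ / 2) hκ2
  have hx : Tendsto (fun R : ℕ => (2 : ℝ) * R + 3) atTop atTop :=
    tendsto_atTop_add_const_right _ _ (Tendsto.const_mul_atTop (by norm_num : (0 : ℝ) < 2) tendsto_natCast_atTop_atTop)
  have hcomp := hlim.comp hx
  have hconst : Tendsto (fun R : ℕ => (d : ℝ) * Real.exp (3 * κ / 2 - κ * (1 - (R₀ : ℝ))) *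
      ((fun x : ℝ => x ^ (d : ℝ) * Real.exp (-(κ / 2) * x)) ((2 : ℝ) * R + 3))) atTop (𝓝 0) := by
    simpa using hcomp.const_mul ((d : ℝ) * Real.exp (3 * κ / 2 - κ * (1 - (R₀ : ℝ))))
  refine hconst.congr fun R => ?_
  dsimp only
  rw [Real.rpow_natCast]
  have : Real.exp (-κ * ((R : ℝ) + 1 - R₀)) =
      Real.exp (3 * κ / 2 - κ * (1 - (R₀ : ℝ))) * Real.exp (-(κ / 2) * (2 * R + 3)) := by
    rw [← Real.exp_add]; congr 1; ring
  rw [this]; ring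

/-! ### The U3 boundary bound ⇒ vanishing boundary influence (B2) ⇒ uniqueness -/

/-- **From the boundary-tilt bound to vanishing boundary influence.** If at tree coupling `β` the kernel
means of every smooth cylinder observable `matrixCylinder Λ f` (`LinkLipschitz f δ`) differ between two
boundary conditions by at most `C · (Σδ) · Σ_{b ∈ collar(E) \ E} e^{-κ·setDistEdges Λ {b}}` for every finite
`E ⊇ Λ` (the shape of U3's `kernel_boundary_influence_le`, with `κ > 0`), then
`SmoothKernelInfluenceVanishes d N β`: take `E` = a large cube of links. Nothing is asserted about the
hypothesis. -/
theorem smoothKernelInfluenceVanishes_of_boundaryBound {β κ C : ℝ} (hκ : 0 < κ)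
    (hB : ∀ (E Λ : Finset (ZdEdge d)), Λ ⊆ E →
      ∀ (η η' : LGConfig d (Matrix.specialUnitaryGroup (Fin N) ℂ)) (f : Cfg ↥Λ N → ℝ), ContDiff ℝ ∞ f →
      ∀ (δ : ↥Λ → ℝ), (∀ e, 0 ≤ δ e) → LinkLipschitz f δ →
        |∫ U, matrixCylinder Λ f U ∂(ymSpecification (d := d) (fundamentalRep (Fin N)) β E η) -
          ∫ U, matrixCylinder Λ f U ∂(ymSpecification (d := d) (fundamentalRep (Fin N)) β E η')| ≤
        C * (∑ e, δ e) * ∑ b ∈ ((plaquettesTouching E).biUnion plaquetteEdges) \ E,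
          Real.exp (-κ * setDistEdges Λ {b})) :
    SmoothKernelInfluenceVanishes d N β := by
  intro Λ f hf δ hδ hL ε hε
  set S : ℝ := ∑ e, δ e with hS
  have hS0 : 0 ≤ S := Finset.sum_nonneg fun e _ => hδ e
  rcases Λ.eq_empty_or_nonempty with hΛ | hΛ
  · -- empty support: `Σδ = 0`, the bound is `0` for `E = Λ`
    refine ⟨Λ, fun η η' => ?_⟩
    have hS' : S = 0 := by
      rw [hS]
      have : IsEmpty ↥Λ := by rw [hΛ]; infer_instance
      exact Finset.sum_eq_zero fun e _ => (IsEmpty.false e).elim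
    have key := hB Λ Λ le_rfl η η' f hf δ hδ hL
    rw [← hS, hS', mul_zero, zero_mul] at key
    exact key.trans hε.le
  · obtain ⟨R₀, hsub⟩ := exists_subset_cube Λ
    -- the cube bound `C S d (2R+3)^d e^{-κ(R+1-R₀)} → 0`
    have hlim : Tendsto (fun R : ℕ => C * S * ((d : ℝ) * (2 * R + 3) ^ d * Real.exp (-κ * ((R : ℝ) + 1 - R₀))))
        atTop (𝓝 0) := by
      simpa using (tendsto_cubeBound d R₀ hκ).const_mul (C * S)
    have hev : ∀ᶠ R : ℕ in atTop, C * S * ((d : ℝ) * (2 * R + 3) ^ d * Real.exp (-κ * ((R : ℝ) + 1 - R₀))) < ε :=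
      (tendsto_order.1 hlim).2 ε hε
    obtain ⟨R, hR⟩ := (hev.and (eventually_ge_atTop R₀)).exists
    obtain ⟨hRε, hRR₀⟩ := hR
    -- `Λ ⊆ Λ_{R₀} ⊆ Λ_R`
    have hsubR : Λ ⊆ box d R ×ˢ (Finset.univ : Finset (Fin d)) := by
      refine hsub.trans (Finset.product_subset_product_left fun x hx => ?_)
      rw [mem_box_iff_supNorm_le] at hx ⊢
      exact hx.trans hRR₀
    refine ⟨box d R ×ˢ (Finset.univ : Finset (Fin d)), fun η η' => ?_⟩
    have key := hB _ Λ hsubR η η' f hf δ hδ hL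
    refine key.trans ?_
    rw [← hS]
    -- sign of `C`: if `C < 0` the bound is `≤ 0 ≤ ε` trivially
    rcases le_or_gt 0 C with hC | hC
    · refine le_trans ?_ hRε.le
      exact mul_le_mul_of_nonneg_left (collarSum_cube_le hΛ hsub hκ.le R) (mul_nonneg hC hS0)
    · have hsum : 0 ≤ ∑ b ∈ ((plaquettesTouching (box d R ×ˢ (Finset.univ : Finset (Fin d)))).biUnion plaquetteEdges) \
          (box d R ×ˢ (Finset.univ : Finset (Fin d))), Real.exp (-κ * setDistEdges Λ {b}) :=
        Finset.sum_nonneg fun b _ => (Real.exp_pos _).le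
      have : C * S * _ ≤ 0 := mul_nonpos_of_nonpos_of_nonneg (mul_nonpos_of_nonpos_of_nonneg hC.le hS0) hsum
      exact this.trans hε.le

/-- **Boundary-tilt bound ⇒ UNIQUE DLR state** at tree coupling `β` (U3-shape binder, `κ > 0`; via U4). -/
theorem hasUniqueGibbsMeasure_of_boundaryBound {β κ C : ℝ} (hκ : 0 < κ)
    (hB : ∀ (E Λ : Finset (ZdEdge d)), Λ ⊆ E →
      ∀ (η η' : LGConfig d (Matrix.specialUnitaryGroup (Fin N) ℂ)) (f : Cfg ↥Λ N → ℝ), ContDiff ℝ ∞ f →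
      ∀ (δ : ↥Λ → ℝ), (∀ e, 0 ≤ δ e) → LinkLipschitz f δ →
        |∫ U, matrixCylinder Λ f U ∂(ymSpecification (d := d) (fundamentalRep (Fin N)) β E η) -
          ∫ U, matrixCylinder Λ f U ∂(ymSpecification (d := d) (fundamentalRep (Fin N)) β E η')| ≤
        C * (∑ e, δ e) * ∑ b ∈ ((plaquettesTouching E).biUnion plaquetteEdges) \ E,
          Real.exp (-κ * setDistEdges Λ {b})) :
    HasUniqueGibbsMeasure (ymSpecification (d := d) (fundamentalRep (Fin N)) β) :=
  hasUniqueGibbsMeasure_of_smoothKernelInfluenceVanishes (smoothKernelInfluenceVanishes_of_boundaryBound hκ hB)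

/-! ### The sharp window: `SharpUniqueness`, `MassGapBelow`, `ImprovedThreshold` -/

/-- **The cell's uniqueness claim at the sharp window from a boundary-tilt bound at every 't Hooft coupling
`|β'| < 1/(8d)`** (tree coupling `N β'`; U3's ★ conclusion shape as the binder): `HessianSharp.SharpUniqueness d N`,
i.e. for every `|β'| < 1/(8d)` the `SU(N)` Wilson specification at coupling `N β'` has exactly one DLR state.
Nothing is asserted about the binder (supplied by U1 + U2 + U3). -/
theorem sharpUniqueness_of_boundaryBound
    (hU3 : ∀ β' : ℝ, |β'| < HessianSharp.sharpThresholdSU d → ∃ κ C : ℝ, 0 < κ ∧ 0 ≤ C ∧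
      ∀ (E Λ : Finset (ZdEdge d)), Λ ⊆ E →
      ∀ (η η' : LGConfig d (Matrix.specialUnitaryGroup (Fin N) ℂ)) (f : Cfg ↥Λ N → ℝ), ContDiff ℝ ∞ f →
      ∀ (δ : ↥Λ → ℝ), (∀ e, 0 ≤ δ e) → LinkLipschitz f δ →
        |∫ U, matrixCylinder Λ f U ∂(ymSpecification (d := d) (fundamentalRep (Fin N)) ((N : ℝ) * β') E η) -
          ∫ U, matrixCylinder Λ f U ∂(ymSpecification (d := d) (fundamentalRep (Fin N)) ((N : ℝ) * β') E η')| ≤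
        C * (∑ e, δ e) * ∑ b ∈ ((plaquettesTouching E).biUnion plaquetteEdges) \ E,
          Real.exp (-κ * setDistEdges Λ {b})) :
    HessianSharp.SharpUniqueness d N := by
  intro β' hβ'
  obtain ⟨κ, C, hκ, -, hB⟩ := hU3 β' hβ'
  exact hasUniqueGibbsMeasure_of_boundaryBound hκ hB

/-- **`MassGapBelow d N (1/(8d))` from the boundary-tilt bound and the SZZ transfer fact** (`d, N ≥ 2`):
unique DLR state AND exponential clustering of every DLR state (SZZ form) at every `|β'| < 1/(8d)`. The
transfer fact `shenZhuZhu_massGap_transfer` (SZZ Cor. 4.11 with the Hessian constant as a parameter) is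
discharged by the cell's brick L + torus covariance file when they land; the boundary binder by U1–U3. -/
theorem massGapBelow_sharp_of_boundaryBound (h : shenZhuZhu_massGap_transfer d N)
    (hU3 : ∀ β' : ℝ, |β'| < HessianSharp.sharpThresholdSU d → ∃ κ C : ℝ, 0 < κ ∧ 0 ≤ C ∧
      ∀ (E Λ : Finset (ZdEdge d)), Λ ⊆ E →
      ∀ (η η' : LGConfig d (Matrix.specialUnitaryGroup (Fin N) ℂ)) (f : Cfg ↥Λ N → ℝ), ContDiff ℝ ∞ f →
      ∀ (δ : ↥Λ → ℝ), (∀ e, 0 ≤ δ e) → LinkLipschitz f δ →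
        |∫ U, matrixCylinder Λ f U ∂(ymSpecification (d := d) (fundamentalRep (Fin N)) ((N : ℝ) * β') E η) -
          ∫ U, matrixCylinder Λ f U ∂(ymSpecification (d := d) (fundamentalRep (Fin N)) ((N : ℝ) * β') E η')| ≤
        C * (∑ e, δ e) * ∑ b ∈ ((plaquettesTouching E).biUnion plaquetteEdges) \ E,
          Real.exp (-κ * setDistEdges Λ {b}))
    (hd : 2 ≤ d) (hN : 2 ≤ N) : MassGapBelow d N (HessianSharp.sharpThresholdSU d) :=
  HessianSharp.massGapBelow_sharp_of_uniqueness h (sharpUniqueness_of_boundaryBound hU3) hd hN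

/-- **The cell's track-(a) TARGET TYPE at the sharp window from the boundary-tilt bound and the transfer
fact**: for `d ≥ 3`, `N ≥ 2`, `ImprovedThreshold d N (1/(8d))` — `1/(16(d-1)) < 1/(8d)` and the mass gap
(`MassGapAt`: unique DLR state + SZZ exponential clustering) at every 't Hooft coupling `|β'| < 1/(8d)`.
With U1–U3 and brick L in the tree both hypotheses are theorems and the target is hypothesis-free
(printed `1/(16(d-1))`: SZZ Thm 1.2 / Cor. 1.4; `d = 4`: `1/32` vs `1/48`). -/
theorem improvedThreshold_sharp_of_boundaryBound (h : shenZhuZhu_massGap_transfer d N)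
    (hU3 : ∀ β' : ℝ, |β'| < HessianSharp.sharpThresholdSU d → ∃ κ C : ℝ, 0 < κ ∧ 0 ≤ C ∧
      ∀ (E Λ : Finset (ZdEdge d)), Λ ⊆ E →
      ∀ (η η' : LGConfig d (Matrix.specialUnitaryGroup (Fin N) ℂ)) (f : Cfg ↥Λ N → ℝ), ContDiff ℝ ∞ f →
      ∀ (δ : ↥Λ → ℝ), (∀ e, 0 ≤ δ e) → LinkLipschitz f δ →
        |∫ U, matrixCylinder Λ f U ∂(ymSpecification (d := d) (fundamentalRep (Fin N)) ((N : ℝ) * β') E η) -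
          ∫ U, matrixCylinder Λ f U ∂(ymSpecification (d := d) (fundamentalRep (Fin N)) ((N : ℝ) * β') E η')| ≤
        C * (∑ e, δ e) * ∑ b ∈ ((plaquettesTouching E).biUnion plaquetteEdges) \ E,
          Real.exp (-κ * setDistEdges Λ {b}))
    (hd : 3 ≤ d) (hN : 2 ≤ N) : ImprovedThreshold d N (HessianSharp.sharpThresholdSU d) :=
  HessianSharp.improvedThreshold_sharp_of_uniqueness h (sharpUniqueness_of_boundaryBound hU3) hd hN

end SharpUniquenessJoin

end Summit.Ventures.YMGap
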